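import Mathlib.RingTheory.Regular.RegularSequence
import Mathlib.RingTheory.Localization.AtPrime.Basic
import Mathlib.RingTheory.LocalProperties.Basic
import Literature.RingTheory.TightClosure.TightClosure
import Summits.ResolutionOfSingularities.ResolutionOfSingularities.Theorems.FrobeniusLadderFInjectiveMacaulayficationRetractDescent
import HarnessLib

/-!
# The CM + Frobenius-closed clause descends along a retraction from local data on the top ring
(crux `FInjectiveMacaulayfication`, line `Sketch`, stub `stub_clauseOfRetract`)

Support file for crux stmt-ResolutionOfSingularities-15315 (`FrobeniusLadder.FInjectiveMacaulayfication`,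
line `Sketch`), cycle 4 "degree-zero descent" package: the ABSTRACT CORE of degree-zero descent.

Let `A → B` be an algebra of commutative rings, `A` of prime characteristic `p`, admitting an `A`-linear
retraction `ρ : B → A` with `ρ 1 = 1` (so `ρ (algebraMap A B a) = ρ (a • 1) = a`; think of the
degree-`0` part `A = T₀ ⊆ T = B` of a `ℤ`-graded ring, `ρ` the projection to degree `0`), and let
`s : Fin d → A`. Suppose that at EVERY maximal ideal `P` of `B` the images of `s` in
`B_P = Localization.AtPrime P` form a weakly regular sequence and generate a Frobenius closed ideal
(inline form: `y ^ q ∈ span {z ^ q | z ∈ (s)B_P} → y ∈ (s)B_P`, `q = p ^ e`). Then `s` is a weakly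
regular sequence on `A` and `(s)A` is Frobenius closed.

Proof. Both conclusions are ideal-membership statements, and ideal membership in `B` is tested at the
maximal ideals (`Ideal.mem_of_localization_maximal`).
* Weak regularity of a list `rs` on the ring itself says `rs[i] * a ∈ (rs_{<i}) → a ∈ (rs_{<i})`
  (`isWeaklyRegular_iff_mem`). If `sᵢ a ∈ (s_{<i})A` then `sᵢ a ∈ (s_{<i})B_P` for every `P`, so
  `a ∈ (s_{<i})B_P` for every `P` by the local hypothesis, so `a ∈ (s_{<i})B`
  (`isWeaklyRegular_of_localization_maximal`), and `a = ρ (algebraMap a) ∈ (s_{<i})A` because `ρ` is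
  `A`-linear and maps `I.map (algebraMap A B) = I • B` into `I`
  (`isWeaklyRegular_of_retract_of_localization`).
* If `y ^ q ∈ (s)^[q] A` then `(algebraMap y) ^ q ∈ ((s)B_P)^[q]` for every `P` (Frobenius-power
  brackets extend along ring maps), so `algebraMap y ∈ (s)B_P` for every `P`, so `algebraMap y ∈ (s)B`
  (`mem_of_frobenius_localization_maximal`), and `y = ρ (algebraMap y) ∈ (s)A`.
The two transport lemmas (`weaklyFRegularClause_of_retract_map_mem`: brackets extend along the algebra
map; `weaklyFRegularClause_of_retract_rho_mem`: `ρ` maps `IB` into `I`) are those of the sibling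
retract-descent files (`…Theorems.FRationalResolution.weaklyFRegularClause_of_retract`, E3
`…Theorems.FInjectiveMacaulayfication.Retract.frobeniusClosed_of_retract`). No Noetherian or domain
hypothesis and no named facts are used; the hypothesis is only needed at the maximal ideals containing
`(s)B`, but is assumed at all of them, as registered.

## References

* [HochsterHuneke1990] M. Hochster, C. Huneke, *Tight closure, invariant theory, and the
  Briançon–Skoda theorem*, J. Amer. Math. Soc. 3 (1990), Prop. 4.12 (direct summands).
* [BrunsHerzog1998] W. Bruns, J. Herzog, *Cohen–Macaulay rings*, rev. ed., CUP 1998, §1.1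
  (regular sequences), §10.1 (Frobenius powers).
* [FedderWatanabe1989] R. Fedder, K.-i. Watanabe, *A characterization of F-regularity in terms of
  F-purity*, MSRI Publ. 15 (1989), Def. 1.5, Remark 1.9 (Frobenius closed ideals).
-/

-- single-problem summit: the doubled namespace component is forced
set_option linter.dupNamespace false

namespace Summit.ResolutionOfSingularities.ResolutionOfSingularities.Theorems.FInjectiveMacaulayfication.RetractClause

open RingTheory.Sequence Literature.RingTheory.TightClosure
open Summit.ResolutionOfSingularities.ResolutionOfSingularities.Theorems.FRationalResolution

/-- Weak regularity of a list `rs` on the ring itself, as ideal membership: `rs` is weakly regular on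
`R` iff `rs[i] * a ∈ (rs_{<i}) → a ∈ (rs_{<i})` for all `i < |rs|` and all `a : R`
(`R ⧸ (rs_{<i}) • ⊤ = R ⧸ (rs_{<i})` and `isSMulRegular_quotient_iff_mem_of_smul_mem`). [folklore] -/
theorem isWeaklyRegular_iff_mem {R : Type*} [CommRing R] (rs : List R) :
    IsWeaklyRegular R rs ↔ ∀ (i : ℕ) (h : i < rs.length) (a : R),
      rs[i] * a ∈ Ideal.ofList (rs.take i) → a ∈ Ideal.ofList (rs.take i) := by
  rw [isWeaklyRegular_iff]
  refine forall₂_congr fun i _ => ?_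
  rw [isSMulRegular_quotient_iff_mem_of_smul_mem, Ideal.smul_eq_mul, Ideal.mul_top]
  rfl

/-- **Weak regularity on a ring is local**: if the image of `rs` in `B_P` is a weakly regular sequence
on `B_P` for every maximal ideal `P` of `B`, then `rs` is a weakly regular sequence on `B` — the
membership `a ∈ (rs_{<i})` is tested at the maximal ideals (`Ideal.mem_of_localization_maximal`).
[folklore] -/
theorem isWeaklyRegular_of_localization_maximal {B : Type*} [CommRing B] (rs : List B)
    (h : ∀ (P : Ideal B) (_ : P.IsMaximal), IsWeaklyRegular (Localization.AtPrime P)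
      (rs.map (algebraMap B (Localization.AtPrime P)))) :
    IsWeaklyRegular B rs := by
  rw [isWeaklyRegular_iff_mem]
  intro i hi a ha
  refine Ideal.mem_of_localization_maximal fun P hP => ?_
  have hi' : i < (rs.map (algebraMap B (Localization.AtPrime P))).length := by
    rwa [List.length_map]
  have ha' := Ideal.mem_map_of_mem (algebraMap B (Localization.AtPrime P)) ha
  rw [Ideal.map_ofList, List.map_take] at ha' ⊢
  refine (isWeaklyRegular_iff_mem _).mp (h P hP) i hi' _ ?_
  rwa [List.getElem_map, ← map_mul]

/-- `ρ ∘ algebraMap A B = id` for an `A`-linear map `ρ : B → A` with `ρ 1 = 1`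
(`algebraMap a = a • 1`). [folklore] -/
theorem retract_algebraMap {A B : Type*} [CommRing A] [CommRing B] [Algebra A B] (ρ : B →ₗ[A] A)
    (hρ : ρ 1 = 1) (a : A) : ρ (algebraMap A B a) = a := by
  rw [Algebra.algebraMap_eq_smul_one, map_smul, hρ, smul_eq_mul, mul_one]

/-- An `A`-linear map `ρ : B → A` sends the extended ideal `I.map (algebraMap A B) = I • B` back into
`I`. [folklore] -/
theorem retract_mem {A B : Type} [CommRing A] [CommRing B] [Algebra A B] (ρ : B →ₗ[A] A)
    (I : Ideal A) {x : B} (hx : x ∈ I.map (algebraMap A B)) : ρ x ∈ I := by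
  simpa only [one_mul] using weaklyFRegularClause_of_retract_rho_mem ρ I hx 1

/-- **Weak regularity descends along a retraction from local data on the top ring.** Along an algebra
`A → B` with an `A`-linear retraction `ρ : B → A`, `ρ 1 = 1`: if for every maximal ideal `P` of `B`
the image of the list `rs` of elements of `A` in `B_P` is weakly regular on `B_P`, then `rs` is weakly
regular on `A`. By `isWeaklyRegular_of_localization_maximal` the image of `rs` is weakly regular on
`B`; then if `rᵢ a ∈ (r_{<i})A` we get `rᵢ · a ∈ (r_{<i})B`, so `algebraMap a ∈ (r_{<i})B`, and
`a = ρ (algebraMap a) ∈ (r_{<i})A` (`retract_mem`, `retract_algebraMap`). [folklore] -/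
theorem isWeaklyRegular_of_retract_of_localization {A B : Type} [CommRing A] [CommRing B]
    [Algebra A B] (ρ : B →ₗ[A] A) (hρ : ρ 1 = 1) (rs : List A)
    (h : ∀ (P : Ideal B) (_ : P.IsMaximal), IsWeaklyRegular (Localization.AtPrime P)
      ((rs.map (algebraMap A B)).map (algebraMap B (Localization.AtPrime P)))) :
    IsWeaklyRegular A rs := by
  have hB := isWeaklyRegular_of_localization_maximal (rs.map (algebraMap A B)) h
  rw [isWeaklyRegular_iff_mem] at hB ⊢
  intro i hi a ha
  have hi' : i < (rs.map (algebraMap A B)).length := by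
    rwa [List.length_map]
  have ha' := Ideal.mem_map_of_mem (algebraMap A B) ha
  rw [Ideal.map_ofList, List.map_take, map_mul] at ha'
  have h1 := hB i hi' (algebraMap A B a) (by rwa [List.getElem_map])
  rw [← List.map_take, ← Ideal.map_ofList] at h1
  rw [← retract_algebraMap ρ hρ a]
  exact retract_mem ρ _ h1

/-- **The inline Frobenius-closedness clause is local**: if for every maximal ideal `P` of `B` the
extension `J B_P` satisfies `y ^ q ∈ span {z ^ q | z ∈ J B_P} → y ∈ J B_P` (`q = p ^ e`), then `J`
satisfies `y ^ q ∈ span {z ^ q | z ∈ J} → y ∈ J`: Frobenius-power brackets extend along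
`B → B_P` (`weaklyFRegularClause_of_retract_map_mem`) and membership in `J` is tested at the maximal
ideals (`Ideal.mem_of_localization_maximal`). [folklore] -/
theorem mem_of_frobenius_localization_maximal (p : ℕ) {B : Type} [CommRing B] (J : Ideal B)
    (h : ∀ (P : Ideal B) (_ : P.IsMaximal) (y : Localization.AtPrime P),
      (∃ e : ℕ, y ^ p ^ e ∈ Ideal.span ((fun z : Localization.AtPrime P => z ^ p ^ e) ''
        (J.map (algebraMap B (Localization.AtPrime P)) : Set (Localization.AtPrime P)))) →
      y ∈ J.map (algebraMap B (Localization.AtPrime P)))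
    {y : B} (hy : ∃ e : ℕ, y ^ p ^ e ∈ Ideal.span ((fun z : B => z ^ p ^ e) '' (J : Set B))) :
    y ∈ J := by
  obtain ⟨e, he⟩ := hy
  refine Ideal.mem_of_localization_maximal fun P hP => h P hP _ ⟨e, ?_⟩
  rw [← map_pow]
  exact weaklyFRegularClause_of_retract_map_mem J (p ^ e) he

/-- **Degree-zero descent, abstract core** (Sketch `stub_clauseOfRetract`). Let `A → B` be an algebra
of commutative rings, `A` of prime characteristic `p`, with an `A`-linear retraction `ρ : B → A`,
`ρ 1 = 1`, and let `s : Fin d → A`. If at every maximal ideal `P` of `B` the images of `s` in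
`B_P = Localization.AtPrime P` form a weakly regular sequence and generate an ideal satisfying the
inline Frobenius-closedness clause, then `s` is a weakly regular sequence on `A` and `(s)A` is
Frobenius closed. Weak regularity: `isWeaklyRegular_of_retract_of_localization`. Frobenius
closedness (`isFrobeniusClosed_iff`): if `y ^ q ∈ (s)^[q]` then `(algebraMap y) ^ q ∈ ((s)B)^[q]`,
so `algebraMap y ∈ (s)B` by `mem_of_frobenius_localization_maximal`, and
`y = ρ (algebraMap y) ∈ (s)A`. The identifications `((s)A · B) · B_P = (s)B_P` and
`map (map (ofFn s)) = ofFn (image of s)` are `Ideal.map_map`/`Ideal.map_span`/`Set.range_comp` and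
`List.map_ofFn`. [folklore] -/
theorem stub_clauseOfRetract : ∀ (p : ℕ) [Fact p.Prime] (A B : Type) [CommRing A] [CommRing B]
    [Algebra A B] [CharP A p] (ρ : B →ₗ[A] A), ρ 1 = 1 → ∀ (d : ℕ) (s : Fin d → A),
    (∀ (P : Ideal B) [P.IsMaximal],
      RingTheory.Sequence.IsWeaklyRegular (Localization.AtPrime P)
          (List.ofFn fun i => algebraMap B (Localization.AtPrime P) (algebraMap A B (s i))) ∧
        ∀ y : Localization.AtPrime P, (∃ e : ℕ, y ^ p ^ e ∈ Ideal.span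
          ((fun z : Localization.AtPrime P => z ^ p ^ e) ''
            (Ideal.span (Set.range fun i => algebraMap B (Localization.AtPrime P) (algebraMap A B (s i))) :
              Set (Localization.AtPrime P)))) →
          y ∈ Ideal.span (Set.range fun i => algebraMap B (Localization.AtPrime P) (algebraMap A B (s i)))) →
    RingTheory.Sequence.IsWeaklyRegular A (List.ofFn s) ∧
      Literature.RingTheory.TightClosure.IsFrobeniusClosed p (Ideal.span (Set.range s)) := by
  intro p _ A B _ _ _ _ ρ hρ d s h
  -- the extended-then-localized ideal / list, aligned with the inline hypothesis
  have hI : ∀ (P : Ideal B) (_ : P.IsMaximal),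
      ((Ideal.span (Set.range s)).map (algebraMap A B)).map
          (algebraMap B (Localization.AtPrime P)) =
        Ideal.span (Set.range fun i =>
          algebraMap B (Localization.AtPrime P) (algebraMap A B (s i))) := by
    intro P _
    rw [Ideal.map_map, Ideal.map_span, ← Set.range_comp]
    rfl
  have hL : ∀ (P : Ideal B) (_ : P.IsMaximal),
      ((List.ofFn s).map (algebraMap A B)).map (algebraMap B (Localization.AtPrime P)) =
        List.ofFn fun i => algebraMap B (Localization.AtPrime P) (algebraMap A B (s i)) := by
    intro P _
    rw [List.map_ofFn, List.map_ofFn]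
    rfl
  refine ⟨?_, ?_⟩
  · refine isWeaklyRegular_of_retract_of_localization ρ hρ (List.ofFn s) fun P hP => ?_
    rw [hL P hP]
    exact (@h P hP).1
  · rw [isFrobeniusClosed_iff]
    rintro y ⟨e, he⟩
    have h1 : algebraMap A B y ∈ (Ideal.span (Set.range s)).map (algebraMap A B) := by
      refine mem_of_frobenius_localization_maximal p _ (fun P hP => ?_) ⟨e, ?_⟩
      · rw [hI P hP]
        exact (@h P hP).2
      · rw [← map_pow]
        exact weaklyFRegularClause_of_retract_map_mem _ (p ^ e) he
    rw [← retract_algebraMap ρ hρ y]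
    exact retract_mem ρ _ h1

end Summit.ResolutionOfSingularities.ResolutionOfSingularities.Theorems.FInjectiveMacaulayfication.RetractClause
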